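import Summits.BirchSwinnertonDyer.BirchSwinnertonDyer.Theorems.BiquadraticEisensteinDescentHeegnerTwistCouplingInSupplySqrtTwoCellFifteen
import Summits.BirchSwinnertonDyer.BirchSwinnertonDyer.Theorems.BiquadraticEisensteinDescentHeegnerTwistCouplingInSupplySqrtTwoCorner
import Summits.BirchSwinnertonDyer.BirchSwinnertonDyer.Theorems.BiquadraticEisensteinDescentHeegnerTwistCouplingInSupplyThreeSquaresPinCorner
import HarnessLib

set_option linter.dupNamespace false -- `Summit.BirchSwinnertonDyer.BirchSwinnertonDyer.Theorems.…` (summit = sub)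
set_option autoImplicit false

/-!
# Crux `HeegnerTwistCouplingInSupply` (stmt-BirchSwinnertonDyer-21381) — card `sqrt2-isogeny-heegner-pin`, the `j = 8000` CORNER at
# `p ≡ 15 (mod 16)`: targets T_B (`p ≡ ±1 (mod 5)`, `K′ = ℚ(√−5ℓ)`) and T_C (`p ≡ 2 (mod 3)`, `K′ = ℚ(√−3ℓ)`) for
# `W = B_p : y² = x³ + 4p x² + 2p² x`, modulo Burungale–Tian + Deuring–Hecke ONLY

Route `BiquadraticEisensteinDescent` (cell `pub/bsd-wall`, width seat `bsd-wall-cm-bed-w2` g12; `--supports` 21381, helper). Companion of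
`…SqrtTwoCorner` (seat `bed-w1` g10: target T_A at `p ≡ 5 (mod 8)` on CELL-5, and the family basics `quadraticTwist_B`, `j_B`,
`eq_two_or_eq_of_prime_dvd_conductorNorm_B`, `L_one_ne_zero_B_neg_of_selmerCorank`, imported BY NAME). Here the other inert class `p ≡ 7 (mod 8)` — in its provable half
`p ≡ 15 (mod 16)` (the card's mod-16 dichotomy: `2 ± √2 ∈ 𝔽_p^{×2}` iff `p ≡ ±1 (16)`; PARI: 936/936 clean vs 0/1045 for `p ≡ 7 (16)`):

* §1 `L_twist_ne_zero_of_cell` — **the `L`-half on CELL-15**: `p ≡ 15 (16)` prime, `m′ > 0` square-free, `p ∤ m′`, prime factors of `m′`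
  `≡ ±3 (8)`, `(−m′/p) = +1` ⇒ `L(B_p^{(−m′)}, 1) = L(B_{−pm′}, 1) ≠ 0` (descent input = the UNCONDITIONAL
  `…SqrtTwoCellFifteen.selmerCorank_two_eq_zero`, the `L`-bridge is bed-w1's cell-agnostic `L_one_ne_zero_B_neg_of_selmerCorank`);
* §2 ★ `cruxOnBpCornerTB_of_two_facts` (T_B: dual pin `ℓ ≡ 3 (8)`, `(ℓ/p) = −1`, `ℓ < p` — `exists_dualPin_heegnerData`; `K′ = ℚ(√−5ℓ)` by
  `exists_witnessField_five`; `m′ = 5ℓ`), ★ `cruxOnBpCornerTC_of_two_facts` (T_C: three-squares pin `ℓ ≡ 5 (8)`, `(ℓ/p) = −1`, `ℓ < 2p` —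
  `exists_pin_heegnerData`; `K′ = ℚ(√−3ℓ)` by `exists_witnessField`; `m′ = 3ℓ`), ★ `cruxOnBpCornerFifteenCellA_of_two_facts` (cell A:
  `p ≡ ±2 (mod 5)`, indefinite-pin partner `q ≡ 3 (8)`, `(q/p) = +1`, `h(−5q) < p` — `exists_threePlus_classNumber_lt`; `K′ = ℚ(√−5q)`;
  `m′ = 5q`), ★★ `cruxOnBpCornerFifteen_of_two_facts` — for EVERY prime `p ≡ 15 (mod 16)`: an imaginary quadratic `K′` with
  `4 < |d_{K′}|`, Heegner for `N(B_p)` (prime support `{2, p}`, no modularity), `L(B_p^{(d_{K′})}, 1) ≠ 0`, `h(K′) < p`, `p ∤ h(K′)` — the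
  CONCLUSION of crux 21381 for `W = B_p`, modulo `hBT` (Burungale–Tian 2026 Thm 1.1) and `hH` (Deuring–Hecke) only. The binders
  `IsGloballyMinimal`, `NeZero N` mirror the crux and are unused.

HONEST FRAMING: typed sub-corner theorems on ONE CM family (`j = 8000`), a measure-zero slice of «all CM `W` of analytic rank one»; the
residual of the crux (C⁺: positive density of `p ∤ h` in a Heegner progression, `p ≥ 5`) is untouched; crux 21381 is NOT closed; BSD is
not proved by any of this. (The other half `p ≡ 7 (mod 16)` of the inert class is NOT a cell: PARI 0/1045 clean — `2 ± √2` are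
non-squares there.) THEOREMS ONLY; supports stmt-BirchSwinnertonDyer-21381.
-/

noncomputable section

open scoped Classical

namespace Summit.BirchSwinnertonDyer.BirchSwinnertonDyer.Theorems.BiquadraticEisensteinDescentHeegnerTwistCouplingInSupplySqrtTwoCornerFifteen

open _root_.WeierstrassCurve Literature.NumberTheory.EllipticCurves
open Summit.BirchSwinnertonDyer.BirchSwinnertonDyer.Theorems.BiquadraticEisensteinDescentHeegnerTwistCouplingInSupplySqrtTwoCell (isElliptic_B)
open Summit.BirchSwinnertonDyer.BirchSwinnertonDyer.Theorems.BiquadraticEisensteinDescentHeegnerTwistCouplingInSupplySqrtTwoCellFifteen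
  (selmerCorank_two_eq_zero not_isSquare_of_jacobiSym_eq_neg_one)
open Summit.BirchSwinnertonDyer.BirchSwinnertonDyer.Theorems.BiquadraticEisensteinDescentHeegnerTwistCouplingInSupplySqrtTwoCorner
  (quadraticTwist_B eq_two_or_eq_of_prime_dvd_conductorNorm_B L_one_ne_zero_B_neg_of_selmerCorank)
open Summit.BirchSwinnertonDyer.BirchSwinnertonDyer.Theorems.BiquadraticEisensteinDescentHeegnerTwistCouplingInSupplyThreeSquaresPin
  (exists_pin_heegnerData)
open Summit.BirchSwinnertonDyer.BirchSwinnertonDyer.Theorems.BiquadraticEisensteinDescentHeegnerTwistCouplingInSupplyThreeSquaresPinCorner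
  (exists_witnessField squarefree_three_mul)
open Summit.BirchSwinnertonDyer.BirchSwinnertonDyer.Theorems.BiquadraticEisensteinDescentHeegnerTwistCouplingInSupplyThreeSquaresPinDual
  (exists_dualPin_heegnerData)
open Summit.BirchSwinnertonDyer.BirchSwinnertonDyer.Theorems.BiquadraticEisensteinDescentHeegnerTwistCouplingInSupplyThreeSquaresPinCornerDual
  (exists_witnessField_five squarefree_five_mul)
open Summit.BirchSwinnertonDyer.BirchSwinnertonDyer.Theorems.BiquadraticEisensteinDescentHeegnerTwistCouplingInSupplyIndefinitePinWitness
  (exists_threePlus_classNumber_lt exists_witnessField_five_of jacobiSym_neg_five_mul_cellA ne_of_jacobiSym_ne_zero)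

/-! ## §1 CELL-15 ⇒ `L(B_p^{(−m′)}, 1) ≠ 0` for `p ≡ 15 (mod 16)` and admissible `m′` -/

section Cell

/-- **The `L`-half on CELL-15.** For a prime `p ≡ 15 (mod 16)` and `m′ > 0` square-free with `p ∤ m′`, every prime factor
`≡ ±3 (mod 8)` and `(−m′/p) = +1` (so `(m′/p) = −1`, as `(−1/p) = −1`): `L(B_p^{(−m′)}, 1) = L(B_{−pm′}, 1) ≠ 0`, modulo Burungale–Tian
+ Deuring–Hecke (the descent input `corank₂ = 0` is the UNCONDITIONAL `…SqrtTwoCellFifteen.selmerCorank_two_eq_zero`).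
[cite: BurungaleTian2026, Thm. 1.1] [cite: SilvermanATAEC1994, Ch. II Cor. 10.5.1] [cite: SilvermanAEC2009, Prop. X.4.9] -/
theorem L_twist_ne_zero_of_cell (hBT : burungaleTian_analyticRank_eq_zero_of_selmerCorank_eq_zero_of_hasCM)
    (hH : hasEntireLFunction_of_j_mem_maximalCMJInvariants) {p : ℕ} (hp : p.Prime) (hp16 : p % 16 = 15) {m' : ℕ}
    (hm'0 : 0 < m') (hm'sq : Squarefree m') (hpm' : ¬ p ∣ m') (hm'8 : ∀ r : ℕ, r.Prime → r ∣ m' → r % 8 = 3 ∨ r % 8 = 5)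
    (hJ : jacobiSym (-(m' : ℤ)) p = 1) :
    ((⟨0, 4 * (p : ℚ), 0, 2 * (p : ℚ) ^ 2, 0⟩ : WeierstrassCurve ℚ).quadraticTwist ((-(m' : ℤ) : ℤ) : ℚ)).entireLFunction 1
      ≠ 0 := by
  haveI : Fact p.Prime := ⟨hp⟩
  -- the twist is `B_{−m}` with `m = p m′`
  set m : ℤ := (p : ℤ) * (m' : ℤ) with hm
  have hm0 : 0 < m := by have := hp.pos; positivity
  have htw : (⟨0, 4 * (p : ℚ), 0, 2 * (p : ℚ) ^ 2, 0⟩ : WeierstrassCurve ℚ).quadraticTwist ((-(m' : ℤ) : ℤ) : ℚ) =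
      ⟨0, -4 * (m : ℚ), 0, 2 * (m : ℚ) ^ 2, 0⟩ := by
    rw [quadraticTwist_B, hm]; push_cast; ext <;> simp
  rw [htw]
  haveI := isElliptic_B hm0.ne'
  -- `(m′/p) = −1` from `(−m′/p) = +1` and `(−1/p) = −1`
  have hJ' : jacobiSym (m' : ℤ) p = -1 := by
    have hm1 : jacobiSym (-1) p = -1 := by
      rw [jacobiSym.at_neg_one (Nat.odd_iff.mpr (by omega)), ZMod.χ₄_nat_eq_if_mod_four, if_neg (by omega), if_neg (by omega)]
    have : jacobiSym (-(m' : ℤ)) p = jacobiSym (-1) p * jacobiSym (m' : ℤ) p := by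
      rw [← jacobiSym.mul_left]; ring_nf
    rw [this, hm1] at hJ
    linarith [hJ]
  refine (L_one_ne_zero_B_neg_of_selmerCorank hBT hH hm0.ne' (selmerCorank_two_eq_zero hp hp16 hm (by exact_mod_cast hm'0)
    (Int.squarefree_natCast.mpr hm'sq) (fun h => hpm' (by exact_mod_cast h)) (fun r hr hrd => hm'8 r hr (by exact_mod_cast hrd))
    (not_isSquare_of_jacobiSym_eq_neg_one hJ'))).2

end Cell

/-! ## §2 The corner targets T_B and T_C (card `sqrt2-isogeny-heegner-pin`) for `W = B_p`, `p ≡ 15 (mod 16)` -/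

section Corner

/-- ★ **Target T_B** (card `sqrt2-isogeny-heegner-pin`), PROVED modulo Burungale–Tian + Deuring–Hecke: for every prime `p ≡ 15 (mod 16)`
with `p ≡ ±1 (mod 5)`, the dual pin `ℓ` (`ℓ < p`, `ℓ ≡ 3 (mod 8)`, `(ℓ/p) = −1`; `exists_dualPin_heegnerData`) and the Heegner field
`K′ = ℚ(√−5ℓ)` of `N(B_p)` (prime support `{2, p}`) with `L(B_p^{(−5ℓ)}, 1) = L(B_{−5pℓ}, 1) ≠ 0` (CELL-15 with `m′ = 5ℓ`:
`(5ℓ/p) = (5/p)(ℓ/p) = −1`), `h(K′) < p` and `p ∤ h(K′)` — the CONCLUSION of `HeegnerTwistCouplingInSupply` for `W = B_p`.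
[cite: BurungaleTian2026, Thm. 1.1] [cite: SilvermanATAEC1994, Ch. II Cor. 10.5.1] [cite: SilvermanAEC2009, Prop. X.4.9]
[cite: Oesterle1988Gauss, II §3 Proposition p. 57 (27)] -/
theorem cruxOnBpCornerTB_of_two_facts (hBT : burungaleTian_analyticRank_eq_zero_of_selmerCorank_eq_zero_of_hasCM)
    (hH : hasEntireLFunction_of_j_mem_maximalCMJInvariants) :
    ∀ (p : ℕ) [Fact p.Prime] [(⟨0, 4 * (p : ℚ), 0, 2 * (p : ℚ) ^ 2, 0⟩ : WeierstrassCurve ℚ).IsElliptic]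
      [(⟨0, 4 * (p : ℚ), 0, 2 * (p : ℚ) ^ 2, 0⟩ : WeierstrassCurve ℚ).IsGloballyMinimal]
      [NeZero ((⟨0, 4 * (p : ℚ), 0, 2 * (p : ℚ) ^ 2, 0⟩ : WeierstrassCurve ℚ).conductorNorm ℤ)],
      p % 16 = 15 → (p % 5 = 1 ∨ p % 5 = 4) →
      ∃ (ℓ : ℕ) (K : Type) (_ : Field K) (_ : NumberField K),
        ℓ.Prime ∧ ℓ < p ∧ ℓ % 8 = 3 ∧ jacobiSym (ℓ : ℤ) p = -1 ∧
        IsImaginaryQuadratic K ∧ NumberField.discr K = -((5 * ℓ : ℕ) : ℤ) ∧ 4 < (NumberField.discr K).natAbs ∧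
        SatisfiesHeegnerHypothesis ((⟨0, 4 * (p : ℚ), 0, 2 * (p : ℚ) ^ 2, 0⟩ : WeierstrassCurve ℚ).conductorNorm ℤ) K ∧
        ((⟨0, 4 * (p : ℚ), 0, 2 * (p : ℚ) ^ 2, 0⟩ : WeierstrassCurve ℚ).quadraticTwist
          (NumberField.discr K : ℚ)).entireLFunction 1 ≠ 0 ∧
        NumberField.classNumber K < p ∧ ¬ p ∣ NumberField.classNumber K := by
  intro p hpF _ _ _ hp16 hp5
  have hp : p.Prime := hpF.out
  obtain ⟨ℓ, hℓ, hℓlt, hℓ8, hJ, -, hJ5, hsz⟩ := exists_dualPin_heegnerData hp (by omega) hp5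
  obtain ⟨K, iF, iN, hK, hdK, hHg, hcl⟩ := exists_witnessField_five
    (N := (⟨0, 4 * (p : ℚ), 0, 2 * (p : ℚ) ^ 2, 0⟩ : WeierstrassCurve ℚ).conductorNorm ℤ)
    hp (by omega) hℓ hℓ8 hJ5 hsz (fun q hq hqN => eq_two_or_eq_of_prime_dvd_conductorNorm_B hp hq hqN)
  have hℓ5 : ℓ ≠ 5 := by rintro rfl; omega
  have hL := L_twist_ne_zero_of_cell hBT hH hp hp16 (m' := 5 * ℓ) (by omega) (squarefree_five_mul hℓ hℓ5)
    (fun h => by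
      rcases (Nat.Prime.dvd_mul hp).mp h with h5 | hl
      · have := (Nat.prime_dvd_prime_iff_eq hp Nat.prime_five).mp h5; omega
      · have := (Nat.prime_dvd_prime_iff_eq hp hℓ).mp hl; omega)
    (fun r hr hrd => by
      rcases (Nat.Prime.dvd_mul hr).mp hrd with h5 | hl
      · have := (Nat.prime_dvd_prime_iff_eq hr Nat.prime_five).mp h5; omega
      · have := (Nat.prime_dvd_prime_iff_eq hr hℓ).mp hl; omega)
    (by push_cast; exact hJ5)
  refine ⟨ℓ, K, iF, iN, hℓ, hℓlt, hℓ8, hJ, hK, hdK, ?_, hHg, ?_, hcl, fun hdvd =>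
    absurd (Nat.le_of_dvd (NumberField.classNumber_pos K) hdvd) (not_le.mpr hcl)⟩
  · rw [hdK, Int.natAbs_neg, Int.natAbs_natCast]
    have := hℓ.two_le
    omega
  · rw [hdK]
    exact hL

/-- ★ **Target T_C** (card `sqrt2-isogeny-heegner-pin`), PROVED modulo Burungale–Tian + Deuring–Hecke: for every prime `p ≡ 15 (mod 16)`
with `p ≡ 2 (mod 3)`, the three-squares pin `ℓ` (`ℓ < 2p`, `ℓ ≡ 5 (mod 8)`, `(ℓ/p) = −1`; `exists_pin_heegnerData`) and the Heegner
field `K′ = ℚ(√−3ℓ)` of `N(B_p)` with `L(B_p^{(−3ℓ)}, 1) = L(B_{−3pℓ}, 1) ≠ 0` (CELL-15 with `m′ = 3ℓ`: `(3ℓ/p) = (3/p)(ℓ/p) = −1`),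
`h(K′) < p` and `p ∤ h(K′)`. [cite: BurungaleTian2026, Thm. 1.1] [cite: SilvermanATAEC1994, Ch. II Cor. 10.5.1]
[cite: SilvermanAEC2009, Prop. X.4.9] [cite: Oesterle1988Gauss, II §3 Proposition p. 57 (27)] -/
theorem cruxOnBpCornerTC_of_two_facts (hBT : burungaleTian_analyticRank_eq_zero_of_selmerCorank_eq_zero_of_hasCM)
    (hH : hasEntireLFunction_of_j_mem_maximalCMJInvariants) :
    ∀ (p : ℕ) [Fact p.Prime] [(⟨0, 4 * (p : ℚ), 0, 2 * (p : ℚ) ^ 2, 0⟩ : WeierstrassCurve ℚ).IsElliptic]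
      [(⟨0, 4 * (p : ℚ), 0, 2 * (p : ℚ) ^ 2, 0⟩ : WeierstrassCurve ℚ).IsGloballyMinimal]
      [NeZero ((⟨0, 4 * (p : ℚ), 0, 2 * (p : ℚ) ^ 2, 0⟩ : WeierstrassCurve ℚ).conductorNorm ℤ)],
      p % 16 = 15 → p % 3 = 2 →
      ∃ (ℓ : ℕ) (K : Type) (_ : Field K) (_ : NumberField K),
        ℓ.Prime ∧ ℓ < 2 * p ∧ ℓ % 8 = 5 ∧ jacobiSym (ℓ : ℤ) p = -1 ∧
        IsImaginaryQuadratic K ∧ NumberField.discr K = -((3 * ℓ : ℕ) : ℤ) ∧ 4 < (NumberField.discr K).natAbs ∧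
        SatisfiesHeegnerHypothesis ((⟨0, 4 * (p : ℚ), 0, 2 * (p : ℚ) ^ 2, 0⟩ : WeierstrassCurve ℚ).conductorNorm ℤ) K ∧
        ((⟨0, 4 * (p : ℚ), 0, 2 * (p : ℚ) ^ 2, 0⟩ : WeierstrassCurve ℚ).quadraticTwist
          (NumberField.discr K : ℚ)).entireLFunction 1 ≠ 0 ∧
        NumberField.classNumber K < p ∧ ¬ p ∣ NumberField.classNumber K := by
  intro p hpF _ _ _ hp16 hp3
  have hp : p.Prime := hpF.out
  obtain ⟨ℓ, hℓ, hℓlt, hℓ8, hJ, -, hJ3, hsz⟩ := exists_pin_heegnerData hp (by omega)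
  obtain ⟨K, iF, iN, hK, hdK, hHg, hcl⟩ := exists_witnessField
    (N := (⟨0, 4 * (p : ℚ), 0, 2 * (p : ℚ) ^ 2, 0⟩ : WeierstrassCurve ℚ).conductorNorm ℤ)
    hp (by omega) hℓ hℓ8 hJ3 hsz (fun q hq hqN => eq_two_or_eq_of_prime_dvd_conductorNorm_B hp hq hqN)
  have hℓ3 : ℓ ≠ 3 := by rintro rfl; omega
  have hL := L_twist_ne_zero_of_cell hBT hH hp hp16 (m' := 3 * ℓ) (by omega) (squarefree_three_mul hℓ hℓ3)
    (fun h => by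
      rcases (Nat.Prime.dvd_mul hp).mp h with h3 | hl
      · have := (Nat.prime_dvd_prime_iff_eq hp Nat.prime_three).mp h3; omega
      · have := (Nat.prime_dvd_prime_iff_eq hp hℓ).mp hl; omega)
    (fun r hr hrd => by
      rcases (Nat.Prime.dvd_mul hr).mp hrd with h3 | hl
      · have := (Nat.prime_dvd_prime_iff_eq hr Nat.prime_three).mp h3; omega
      · have := (Nat.prime_dvd_prime_iff_eq hr hℓ).mp hl; omega)
    (by push_cast; exact hJ3)
  refine ⟨ℓ, K, iF, iN, hℓ, hℓlt, hℓ8, hJ, hK, hdK, ?_, hHg, ?_, hcl, fun hdvd =>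
    absurd (Nat.le_of_dvd (NumberField.classNumber_pos K) hdvd) (not_le.mpr hcl)⟩
  · rw [hdK, Int.natAbs_neg, Int.natAbs_natCast]
    have := hℓ.two_le
    omega
  · rw [hdK]
    exact hL

/-- ★ **Cell A at `p ≡ 15 (mod 16)`** (the card's "cascade" made exact by the indefinite pin): for every prime `p ≡ 15 (mod 16)` with
`p ≡ ±2 (mod 5)`, a prime `q ≡ 3 (mod 8)` with `(q/p) = +1` and `h(ℚ(√−5q)) < p` (`exists_threePlus_classNumber_lt`: kernel partner table
below `800`, the indefinite `(3,+)` pin `q ≤ 10p` and the class-number-formula size lever above), the Heegner field `K′ = ℚ(√−5q)` of `N(B_p)`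
(`(−5q/p) = (−1/p)(5/p)(q/p) = (−1)(−1)(+1) = +1`) and `L(B_p^{(−5q)}, 1) = L(B_{−5pq}, 1) ≠ 0` (CELL-15 with `m′ = 5q`: `(5q/p) = −1`),
modulo Burungale–Tian + Deuring–Hecke. [cite: BurungaleTian2026, Thm. 1.1] [cite: SilvermanATAEC1994, Ch. II Cor. 10.5.1]
[cite: SilvermanAEC2009, Prop. X.4.9] [cite: Oesterle1988Gauss, II §3 Proposition p. 57 (27)] -/
theorem cruxOnBpCornerFifteenCellA_of_two_facts (hBT : burungaleTian_analyticRank_eq_zero_of_selmerCorank_eq_zero_of_hasCM)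
    (hH : hasEntireLFunction_of_j_mem_maximalCMJInvariants) :
    ∀ (p : ℕ) [Fact p.Prime] [(⟨0, 4 * (p : ℚ), 0, 2 * (p : ℚ) ^ 2, 0⟩ : WeierstrassCurve ℚ).IsElliptic]
      [(⟨0, 4 * (p : ℚ), 0, 2 * (p : ℚ) ^ 2, 0⟩ : WeierstrassCurve ℚ).IsGloballyMinimal]
      [NeZero ((⟨0, 4 * (p : ℚ), 0, 2 * (p : ℚ) ^ 2, 0⟩ : WeierstrassCurve ℚ).conductorNorm ℤ)],
      p % 16 = 15 → (p % 5 = 2 ∨ p % 5 = 3) →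
      ∃ (q : ℕ) (K : Type) (_ : Field K) (_ : NumberField K),
        q.Prime ∧ q % 8 = 3 ∧ jacobiSym (q : ℤ) p = 1 ∧
        IsImaginaryQuadratic K ∧ NumberField.discr K = -((5 * q : ℕ) : ℤ) ∧ 4 < (NumberField.discr K).natAbs ∧
        SatisfiesHeegnerHypothesis ((⟨0, 4 * (p : ℚ), 0, 2 * (p : ℚ) ^ 2, 0⟩ : WeierstrassCurve ℚ).conductorNorm ℤ) K ∧
        ((⟨0, 4 * (p : ℚ), 0, 2 * (p : ℚ) ^ 2, 0⟩ : WeierstrassCurve ℚ).quadraticTwist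
          (NumberField.discr K : ℚ)).entireLFunction 1 ≠ 0 ∧
        NumberField.classNumber K < p ∧ ¬ p ∣ NumberField.classNumber K := by
  intro p hpF _ _ _ hp16 hp5
  have hp : p.Prime := hpF.out
  obtain ⟨q, hq, hq8, hJ, hh⟩ := exists_threePlus_classNumber_lt hp (by omega) hp5 (by omega)
  have hJ5 := jacobiSym_neg_five_mul_cellA (by omega) hp5 hJ
  obtain ⟨K, iF, iN, hK, hdK, hHg, hcl⟩ := exists_witnessField_five_of
    (N := (⟨0, 4 * (p : ℚ), 0, 2 * (p : ℚ) ^ 2, 0⟩ : WeierstrassCurve ℚ).conductorNorm ℤ)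
    hq hq8 hJ5 hh (fun r hr hrN => eq_two_or_eq_of_prime_dvd_conductorNorm_B hp hr hrN)
  have hq5 : q ≠ 5 := by rintro rfl; omega
  have hqp : q ≠ p := ne_of_jacobiSym_ne_zero hp (by rw [hJ]; norm_num)
  have hL := L_twist_ne_zero_of_cell hBT hH hp hp16 (m' := 5 * q) (by have := hq.pos; omega) (squarefree_five_mul hq hq5)
    (fun h => by
      rcases (Nat.Prime.dvd_mul hp).mp h with h5 | hl
      · have := (Nat.prime_dvd_prime_iff_eq hp Nat.prime_five).mp h5; omega
      · exact hqp ((Nat.prime_dvd_prime_iff_eq hp hq).mp hl).symm)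
    (fun r hr hrd => by
      rcases (Nat.Prime.dvd_mul hr).mp hrd with h5 | hl
      · have := (Nat.prime_dvd_prime_iff_eq hr Nat.prime_five).mp h5; omega
      · have := (Nat.prime_dvd_prime_iff_eq hr hq).mp hl; omega)
    (by push_cast; exact hJ5)
  refine ⟨q, K, iF, iN, hq, hq8, hJ, hK, hdK, ?_, hHg, ?_, hcl, fun hdvd =>
    absurd (Nat.le_of_dvd (NumberField.classNumber_pos K) hdvd) (not_le.mpr hcl)⟩
  · rw [hdK, Int.natAbs_neg, Int.natAbs_natCast]
    have := hq.two_le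
    omega
  · rw [hdK]
    exact hL

/-- ★★ **The `j = 8000` corner at EVERY prime `p ≡ 15 (mod 16)`** (the provable half of the inert class `p ≡ 7 (mod 8)`): for
`W = B_p : y² = x³ + 4p x² + 2p² x` there is an imaginary quadratic `K′` with `4 < |d_{K′}|`, the Heegner hypothesis for `N(B_p)` (prime
support `{2, p}`, no modularity), `L(B_p^{(d_{K′})}, 1) ≠ 0`, `h(K′) < p` and `p ∤ h(K′)` — the CONCLUSION of crux
`HeegnerTwistCouplingInSupply` for `W = B_p` — modulo exactly Burungale–Tian's rank-zero `2`-converse for CM curves (`hBT`) and the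
Deuring–Hecke continuation (`hH`); the descent input (CELL-15) is unconditional. Cells: `p ≡ ±1 (mod 5)` by T_B (dual pin, `K′ = ℚ(√−5ℓ)`),
`p ≡ ±2 (mod 5)` by cell A (indefinite pin, `K′ = ℚ(√−5q)`). The binders `IsGloballyMinimal`, `NeZero N` mirror the crux and are unused.
HONEST FRAMING: a typed sub-corner of one CM family; the crux quantifies over all CM `W` of analytic rank one and is NOT closed; BSD is
not proved by this. [cite: BurungaleTian2026, Thm. 1.1] [cite: SilvermanATAEC1994, Ch. II Cor. 10.5.1] [cite: SilvermanAEC2009, Prop. X.4.9] -/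
theorem cruxOnBpCornerFifteen_of_two_facts (hBT : burungaleTian_analyticRank_eq_zero_of_selmerCorank_eq_zero_of_hasCM)
    (hH : hasEntireLFunction_of_j_mem_maximalCMJInvariants) :
    ∀ (p : ℕ) [Fact p.Prime] [(⟨0, 4 * (p : ℚ), 0, 2 * (p : ℚ) ^ 2, 0⟩ : WeierstrassCurve ℚ).IsElliptic]
      [(⟨0, 4 * (p : ℚ), 0, 2 * (p : ℚ) ^ 2, 0⟩ : WeierstrassCurve ℚ).IsGloballyMinimal]
      [NeZero ((⟨0, 4 * (p : ℚ), 0, 2 * (p : ℚ) ^ 2, 0⟩ : WeierstrassCurve ℚ).conductorNorm ℤ)],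
      p % 16 = 15 →
      ∃ (K : Type) (_ : Field K) (_ : NumberField K),
        IsImaginaryQuadratic K ∧ 4 < (NumberField.discr K).natAbs ∧
        SatisfiesHeegnerHypothesis ((⟨0, 4 * (p : ℚ), 0, 2 * (p : ℚ) ^ 2, 0⟩ : WeierstrassCurve ℚ).conductorNorm ℤ) K ∧
        ((⟨0, 4 * (p : ℚ), 0, 2 * (p : ℚ) ^ 2, 0⟩ : WeierstrassCurve ℚ).quadraticTwist
          (NumberField.discr K : ℚ)).entireLFunction 1 ≠ 0 ∧
        NumberField.classNumber K < p ∧ ¬ p ∣ NumberField.classNumber K := by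
  intro p hpF _ _ _ hp16
  have hp : p.Prime := hpF.out
  have hp5 : p % 5 ≠ 0 := fun h => by
    have := (Nat.prime_dvd_prime_iff_eq Nat.prime_five hp).mp (Nat.dvd_of_mod_eq_zero h); omega
  by_cases hB : p % 5 = 1 ∨ p % 5 = 4
  · obtain ⟨-, K, iF, iN, -, -, -, -, hK, -, h4, hHg, hL, hcl, hnd⟩ := cruxOnBpCornerTB_of_two_facts hBT hH p hp16 hB
    exact ⟨K, iF, iN, hK, h4, hHg, hL, hcl, hnd⟩
  · obtain ⟨-, K, iF, iN, -, -, -, hK, -, h4, hHg, hL, hcl, hnd⟩ :=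
      cruxOnBpCornerFifteenCellA_of_two_facts hBT hH p hp16 (by omega)
    exact ⟨K, iF, iN, hK, h4, hHg, hL, hcl, hnd⟩

end Corner


end Summit.BirchSwinnertonDyer.BirchSwinnertonDyer.Theorems.BiquadraticEisensteinDescentHeegnerTwistCouplingInSupplySqrtTwoCornerFifteen

end
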